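import Mathlib.MeasureTheory.Integral.Bochner.Basic
import Mathlib.MeasureTheory.Measure.Lebesgue.Basic
import Mathlib.Analysis.SpecialFunctions.Pow.Real
import HarnessLib

/-!
# Matomäki–Merikoski §7, main terms: the `y`-integral of the product of the two evaluated brackets

Sibling of `SiegelZeroPrimePairsMainTermCutoff.lean` / `…MainTermDyadic.lean`.  Everything here is PROVED
(theorems only; pure measure-theoretic bookkeeping).  In §7 of Matomäki–Merikoski (arXiv:2112.11412, p. 21)
the main term of `Σ̃_{S,S}` becomes, after interchanging the dyadic sums with the `y`-integral,
`∫ g(y/X) B₁(y) B₂(y) dy` with the two brackets `B₁(y) = ∑_{m₁ rough} χ(m₁) log(y/m₁) W(m₁)/m₁`,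
`B₂(y) = ∑_{m₂ rough} χ(m₂) log((±y+h)/m₂) W(m₂)/m₂`, each of which equals `(1 + O(𝓔)) ∏_{p<z}(1−1/p)^{−1}`
(Lemma 2.4 with partial summation), whence the displayed
`∏ (…) ∫ g(y/X) dy · (1 + O(𝓔))²`.  This file proves that last step abstractly:
if `|Bᵢ(y) − V| ≤ ε V` on the support of `g ≥ 0`, then
`|∫ g B₁ B₂ − V² ∫ g| ≤ (2ε + ε²) V² ∫ g` (`MatomakiMerikoski.abs_integral_mul_brackets_sub_le`).

## References

* K. Matomäki, J. Merikoski, IMRN 2023:23, 20337–20384 (arXiv:2112.11412), §7, the display for `Σ̃_{S,S}`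
  ending in `(1 + O_A(…) + O_{C,ε}(…))²`. [cite: MatomakiMerikoski2023, §7 (main term of Σ_{S,S})]
-/

noncomputable section

open MeasureTheory

namespace Literature.Barriers.Parity.MatomakiMerikoski

/-- Pointwise: `|B₁B₂ − V²| ≤ (2ε + ε²) V²` when `|Bᵢ − V| ≤ εV` (`ε, V ≥ 0`). [folklore] -/
theorem abs_mul_sub_sq_le {B₁ B₂ V ε : ℝ} (hV : 0 ≤ V) (hε : 0 ≤ ε) (h₁ : |B₁ - V| ≤ ε * V)
    (h₂ : |B₂ - V| ≤ ε * V) : |B₁ * B₂ - V ^ 2| ≤ (2 * ε + ε ^ 2) * V ^ 2 := by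
  have e : B₁ * B₂ - V ^ 2 = (B₁ - V) * (B₂ - V) + V * (B₁ - V) + V * (B₂ - V) := by ring
  rw [e]
  calc |(B₁ - V) * (B₂ - V) + V * (B₁ - V) + V * (B₂ - V)|
      ≤ |(B₁ - V) * (B₂ - V)| + |V * (B₁ - V)| + |V * (B₂ - V)| := abs_add_three _ _ _
    _ = |B₁ - V| * |B₂ - V| + V * |B₁ - V| + V * |B₂ - V| := by
        rw [abs_mul, abs_mul, abs_mul, abs_of_nonneg hV]
    _ ≤ ε * V * (ε * V) + V * (ε * V) + V * (ε * V) := by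
        gcongr
    _ = (2 * ε + ε ^ 2) * V ^ 2 := by ring

/-- **The `y`-integral of the product of the two brackets** (Matomäki–Merikoski §7, `Σ̃_{S,S}`):
let `g ≥ 0` be integrable and let `B₁, B₂` satisfy `|Bᵢ(y) − V| ≤ ε V` whenever `g(y) ≠ 0` (`ε, V ≥ 0`);
assume `y ↦ g(y) B₁(y) B₂(y)` is integrable.  Then
`|∫ g B₁ B₂ − V² ∫ g| ≤ (2ε + ε²) V² ∫ g`.
[cite: MatomakiMerikoski2023, §7 (main term of Σ_{S,S}, the factor (1 + O(𝓔))²)] -/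
theorem abs_integral_mul_brackets_sub_le {g B₁ B₂ : ℝ → ℝ} {V ε : ℝ} (hV : 0 ≤ V) (hε : 0 ≤ ε)
    (hg : ∀ y, 0 ≤ g y) (hgi : Integrable g)
    (hprod : Integrable (fun y => g y * (B₁ y * B₂ y)))
    (hB : ∀ y, g y ≠ 0 → |B₁ y - V| ≤ ε * V ∧ |B₂ y - V| ≤ ε * V) :
    |(∫ y, g y * (B₁ y * B₂ y)) - V ^ 2 * ∫ y, g y| ≤ (2 * ε + ε ^ 2) * V ^ 2 * ∫ y, g y := by
  -- `∫ g B₁B₂ − V² ∫ g = ∫ g (B₁B₂ − V²)`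
  have hgV : Integrable (fun y => g y * V ^ 2) := hgi.mul_const _
  have hdiff : (∫ y, g y * (B₁ y * B₂ y)) - V ^ 2 * ∫ y, g y = ∫ y, g y * (B₁ y * B₂ y - V ^ 2) := by
    rw [mul_comm (V ^ 2), ← integral_mul_const, ← integral_sub hprod hgV]
    refine integral_congr_ae (Filter.Eventually.of_forall fun y => ?_)
    simp only
    ring
  rw [hdiff]
  -- pointwise bound and integration
  have hint : Integrable (fun y => g y * (B₁ y * B₂ y - V ^ 2)) := by
    have := hprod.sub hgV
    refine this.congr (Filter.Eventually.of_forall fun y => ?_)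
    simp only [Pi.sub_apply]
    ring
  have hpt : ∀ y, |g y * (B₁ y * B₂ y - V ^ 2)| ≤ g y * ((2 * ε + ε ^ 2) * V ^ 2) := by
    intro y
    by_cases hy : g y = 0
    · rw [hy, zero_mul, zero_mul, abs_zero]
    · rw [abs_mul, abs_of_nonneg (hg y)]
      obtain ⟨h₁, h₂⟩ := hB y hy
      exact mul_le_mul_of_nonneg_left (abs_mul_sub_sq_le hV hε h₁ h₂) (hg y)
  calc |∫ y, g y * (B₁ y * B₂ y - V ^ 2)| ≤ ∫ y, |g y * (B₁ y * B₂ y - V ^ 2)| :=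
        abs_integral_le_integral_abs
    _ ≤ ∫ y, g y * ((2 * ε + ε ^ 2) * V ^ 2) := integral_mono hint.abs (hgi.mul_const _) hpt
    _ = (2 * ε + ε ^ 2) * V ^ 2 * ∫ y, g y := by rw [integral_mul_const]; ring

end Literature.Barriers.Parity.MatomakiMerikoski
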